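import Mathlib
import HarnessLib
import Literature.NumberTheory.GaloisRepresentations.GaloisRepOfAlgebraValuedLimit

/-!
# Stub `stub_algebraValuedLimit` (K3) of line `Sketch` for the crux
`Summit.Langlands.Langlands.Theses.QuadraticWindow.GaloisRepOfUnitaryLDS` (stmt-Langlands-15129)

The pure-Galois lever of the line — Galois representations as ALGEBRA-VALUED `ℓ`-adic limits
(Taylor 1991 §1; Goldring–Koskivirta 2019 Thm. 3.5.6 and §11.1) — is proved in the Literature
PROOFS file `Literature/NumberTheory/GaloisRepresentations/GaloisRepOfAlgebraValuedLimit.lean`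
(`exists_semisimple_galoisRep_of_algebraValuedLimit`, accepted p98575); this file is the registered
stub in the skeleton's vocabulary, closed by that theorem verbatim.  References: R. Taylor, Duke
Math. J. 63 (1991) §1; W. Goldring, J.-S. Koskivirta, Invent. Math. 217 (2019) §11.1.
-/

noncomputable section

open scoped NumberField Polynomial
open Polynomial IsDedekindDomain NumberField
open Literature.NumberTheory.GaloisRepresentations

set_option linter.dupNamespace false

namespace Summit.Langlands.Langlands.Theorems.GaloisRepOfUnitaryLDS.HeckeAlgebraValuedLimit

/-- **K3, the registered stub `stub_algebraValuedLimit` of line `Sketch`.**  `K` a number field,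
`E/ℚ_ℓ` finite, `S` a finite set of finite places, `P_v` (`v ∉ S`) prescribed polynomials with
coefficients in `E`.  If for every `m` there are finitely many continuous
`ρ'_i : Γ_K → GL_n(ℚ̄_ℓ)`, unramified with Frobenius characteristic polynomials `Q_i v` at every
`v ∉ S`, `v ∤ ℓ`, and a `δ > 0` such that every integer polynomial in the good Frobenius-coefficient
variables which is `δ`-small on all the `Q_i` is `ℓ^{-m}`-small on `P`, then there is a continuous
semisimple `ρ : Γ_K → GL_n(ℚ̄_ℓ)`, unramified at every `v ∉ S`, `v ∤ ℓ`, with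
`charpoly ρ(Frob_v) = P_v`.  This is
`Literature.NumberTheory.GaloisRepresentations.exists_semisimple_galoisRep_of_algebraValuedLimit`.
[cite: Taylor1991, §1 Theorem 1] [cite: GoldringKoskivirta2019, §11.1 and Thm. 3.5.6] -/
theorem stub_algebraValuedLimit :
    ∀ (K : Type) [Field K] [NumberField K] (n ℓ : ℕ) [Fact ℓ.Prime]
      (E : IntermediateField ℚ_[ℓ] (PadicAlgCl ℓ)), FiniteDimensional ℚ_[ℓ] E →
      ∀ (S : Set (HeightOneSpectrum (𝓞 K))), S.Finite →
      ∀ (P : HeightOneSpectrum (𝓞 K) → (PadicAlgCl ℓ)[X]),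
      (∀ v ∉ S, ∀ k : ℕ, (P v).coeff k ∈ E) →
      (∀ m : ℕ, ∃ (r : ℕ) (ρ' : Fin r → FramedGaloisRep K (PadicAlgCl ℓ) n)
          (Q : Fin r → HeightOneSpectrum (𝓞 K) → (PadicAlgCl ℓ)[X]) (δ : ℝ), 0 < δ ∧
          (∀ i, ∀ v ∉ S, ((ℓ : ℕ) : 𝓞 K) ∉ v.asIdeal →
            (ρ' i).IsUnramifiedAt v ∧ (ρ' i).HasFrobCharpolyAt v (Q i v)) ∧
          ∀ F : MvPolynomial (HeightOneSpectrum (𝓞 K) × ℕ) ℤ,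
            (∀ vk ∈ F.vars, vk.1 ∉ S ∧ ((ℓ : ℕ) : 𝓞 K) ∉ vk.1.asIdeal) →
            (∀ i, ‖MvPolynomial.aeval
                (fun vk : HeightOneSpectrum (𝓞 K) × ℕ => (Q i vk.1).coeff vk.2) F‖ ≤ δ) →
              ‖MvPolynomial.aeval
                  (fun vk : HeightOneSpectrum (𝓞 K) × ℕ => (P vk.1).coeff vk.2) F‖ ≤
                (ℓ : ℝ) ^ (-(m : ℤ))) →
      ∃ ρ : FramedGaloisRep K (PadicAlgCl ℓ) n, ρ.toGaloisRep.IsSemisimple ∧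
        ∀ v ∉ S, ((ℓ : ℕ) : 𝓞 K) ∉ v.asIdeal → ρ.IsUnramifiedAt v ∧ ρ.HasFrobCharpolyAt v (P v) :=
  exists_semisimple_galoisRep_of_algebraValuedLimit

end Summit.Langlands.Langlands.Theorems.GaloisRepOfUnitaryLDS.HeckeAlgebraValuedLimit

end
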